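import Literature.Geometry.Kaehler.ComplexTorusHodgeGroupHodgeCircleSigmaPiRank
import Literature.Geometry.Kaehler.ComplexTorusMumfordTateGroupSigmaPi
import Literature.Geometry.Kaehler.ComplexTorusMumfordTateGroupHodgeCircleProducts
import Literature.Geometry.Kaehler.ComplexTorusMumfordTateGroupComplexPoints
import HarnessLib

/-!
# The Mumford–Tate group of a finite product of complex tori: the multiplier relation
# `det(M_kk)^{2g_l} = det(M_ll)^{2g_k}` on `MT(∏ₖ X_k)(ℝ)` for ANY finite family, `MT(∏ₖ X_k) < ∏ₖ MT(X_k)`, and, for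
# tori on the Hodge-circle locus, `MT(∏ₖ X_k)(ℝ) ⊆ {diag(h_k(z_k)) : |z_k| = |z_l| ≠ 0}` with equality on the split branch
# and `MT(∏ₖ X_k)(ℝ) = h(ℂ^×)` exactly when all `Hom(X_k, X_l) ≠ 0`
# (Moonen 2004, Lemma 4.6, (5.2); Carlson–Müller-Stach–Peters 2017, Problem 15.2.3 (a); Deligne 1982, I §5; Imai 1976, §3)

Layer `Literature/Geometry/Kaehler`, namespace `Literature.Geometry.Kaehler.ComplexTorus`; lane `lit-hodgefound` (Track 2
foundations library, Layer A3/A4 «Mumford–Tate groups of products; CM tori»), prover seat p17, generation 34, self-proposed row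
g34-#3 — pointer (β) of the gen-33 HANDOFF: the `r`-FACTOR form of g33-#3 (`ComplexTorusMumfordTateGroupHodgeCircleProducts`:
for TWO tori on the locus every `M ∈ MT(X₁ × X₂)(ℝ)` is `(h₁(z₁) 0; 0 h₂(z₂))` with `|z₁| = |z₂|`, fibre product on the split
branch, `MT = h(ℂ^×)` ⟺ `Hom ≠ 0`) on p10/p36's dependent product `sigmaPiPeriod Ψ`, any finite index type.  The inclusion
`MT(∏ₖ X_k)(ℝ) ⊆ ∏ₖ MT(X_k)(ℝ)` is p36's `mumfordTateGroup_sigmaPi_le` / `exists_eq_sigmaBlockDiagGL_of_mem_mumfordTateGroup_sigmaPi`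
(`ComplexTorusMumfordTateGroupSigmaPi`); the MULTIPLIER is obtained here WITHOUT a new equation family, from p40's structure
theorem `mem_mumfordTateGroup_iff_exists_smul` («`M ∈ MT(X)(ℝ)` iff `M_ℂ = α · N`, `N ∈ Hg(X)(ℂ)`»,
`ComplexTorusMumfordTateGroupComplexPoints`) and p36's `det_blockDiag'_of_mem_hodgeGroupC_sigmaPi` (the diagonal blocks of
`Hg(∏ₖ X_k)(ℂ)` have determinant `1`): `det(M_kk) = α^{#σ_k}` for ONE `α ∈ ℂ^×`.  On the locus the factors have
`MT(X_k)(ℝ) = h_k(ℂ^×)` (g32-#2's `coe_mumfordTateGroup_eq_range_hodgeSGL_of_coe_hodgeGroup_eq_range`), the split Hodge group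
is g33-#5's `hodgeGroup_sigmaPiPeriod_eq_map_of_coe_eq_range_of_pairwise_homRat_eq_bot`, and the one-class branch is g33-#8 §4
`coe_hodgeGroup_sigmaPiPeriod_eq_range_iff_forall_homRat_ne_bot`; the rank `dim 𝔪𝔱 = r + 1` is g34-#2.  All BY NAME.
THEOREMS ONLY: no definition, no instance, no named fact, nothing conditional (D-0026, net debt 0).

## Sources, verbatim

* B. Moonen, *An introduction to Mumford–Tate groups* (2004), §4 (4.6) Lemma: «`MT(V₁ ⊕ V₂) ⊂ MT(V₁) × MT(V₂)` … the
  projections are surjective»; §5 (5.2): «`MT ⊂ 𝔾_m · (Hg(V₁) × Hg(V₂))` … the central factor `𝔾_m` is counted twice».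
* J. Carlson, S. Müller-Stach, C. Peters, *Period Mappings and Period Domains*, 2nd ed. (2017), §15.2 Problem 15.2.3 (a):
  «the Mumford–Tate group of `H₁ ⊕ H₂` is contained in `𝔾_m · (SMT(H₁) × SMT(H₂))` … the fibre product over `𝔾_m`»;
  Examples 15.2.4 (ii) (CM elliptic curves: «`MT(H¹(C)) = U(1) · 𝔾_m` … is also abelian»).
* P. Deligne, *Hodge cycles on abelian varieties* (1982), I §5 (p. 63): «the Mumford–Tate group of `A` is contained in the
  product of those of the `A_α`».
* H. Imai (1976), §3 Remarks (p. 370 L22–L25, L31–L38): «`Hg(∏_{i,j} Eᵢ^{(j)}) ≅ ∏ᵢ Δ_{mᵢ}(Hg(Eᵢ))`»; B. Moonen, Yu. Zarhin (1999),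
  (0.2)(4), §1, §3 Corollary; B. B. Gordon (1997), §2.3 Lemma (iii) (`MT = 𝔾_m · Hg`), §3 Theorem; D. Lombardo (2019), §2.2
  cases 5, 6 («`MT(A₁ × A₂)` is almost never equal to `MT(A₁) × MT(A₂)`»); H. Lange (2023), §7.2.1 Remark 7.2.2 (2), §7.2.3
  Prop. 7.2.6; A. Beauville (2014), §3 Prop. 3.

## What is proved (real points; `∏ₖ X_k = sigmaPiPeriod Ψ`, `X_k = F_k/Ψ_k(ℤ^{σ k})`, `#σ_k = 2g_k`)

* §1 **THE MULTIPLIER RELATION FOR ANY FINITE FAMILY OF TORI**: every `M ∈ MT(∏ₖ X_k)(ℝ)` has ONE `α ∈ ℂ^×` with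
  `det(M_kk) = α^{#σ_k}` for all `k` (`exists_forall_det_blockDiag'_eq_pow_of_mem_mumfordTateGroup_sigmaPi`), hence
  **`det(M_kk)^{#σ_l} = det(M_ll)^{#σ_k}`** (`det_blockDiag'_pow_eq_of_mem_mumfordTateGroup_sigmaPi`; block form
  `det_pow_eq_of_sigmaBlockDiagGL_mem_mumfordTateGroup_sigmaPi`) — `MT(∏ₖ X_k)` lies in the fibre product of the `MT(X_k)` over
  `𝔾_m` (Moonen (5.2) / CMSP 15.2.3 (a) for `r` summands of any dimensions), and **`MT(∏ₖ X_k)(ℝ) < ∏ₖ MT(X_k)(ℝ)` as soon as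
  two factors are non-zero** (`mumfordTateGroup_sigmaPi_lt_of_ne`: `diag(2·1, 1, …, 1)` violates the relation).
* §2 **ALL FACTORS ON THE HODGE-CIRCLE LOCUS** (`Hg(X_k)(ℝ) = h_k(S¹)`, `g_k ≥ 1`): every `M ∈ MT(∏ₖ X_k)(ℝ)` is
  **`diag(h_k(z_k))` with `z_k ≠ 0` and `|z_k| = |z_l|`**, i.e. `ρ · diag(h_k(e^{iθ_k}))`, `ρ > 0`
  (`exists_eq_blockDiagonal'_hodgeS_of_mem_mumfordTateGroup_sigmaPiPeriod`, `exists_eq_smul_blockDiagonal'_hodgeCircle_…`);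
  **`MT(∏ₖ X_k)(ℝ)` IS COMMUTATIVE** (`mumfordTateGroup_sigmaPiPeriod_comm_of_coe_eq_range`; of CM type in the Mumford–Tate sense).
* §3 **THE SPLIT BRANCH (pairwise `Hom = 0`): `M ∈ MT(∏ₖ X_k)(ℝ) ⟺ M = diag(h_k(z_k))`, `|z_k| = |z_l| ≠ 0`**
  (`mem_mumfordTateGroup_sigmaPiPeriod_iff_of_pairwise_homRat_eq_bot`; the torus `𝔾_m · ∏ₖ U(1)` of rank `#κ + 1`), every sign
  vector `diag(ε_k · 1)` lies in `MT` (`sigmaBlockDiagGL_sign_mem_…`), and **`MT(∏ₖ X_k)(ℝ) ∩ SL = Hg(∏ₖ X_k)(ℝ)`**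
  (`mem_hodgeGroup_sigmaPiPeriod_iff_toGL_mem_mumfordTateGroup_of_pairwise_homRat_eq_bot`).
* §4 **THE ONE-CLASS BRANCH: `MT(∏ₖ X_k)(ℝ) = h(ℂ^×)` ⟺ `Hom(X_k, X_l) ≠ 0` FOR ALL `k ≠ l`** ⟺ the product is on the locus
  (`coe_mumfordTateGroup_sigmaPiPeriod_eq_range_hodgeSGL_iff_forall_homRat_ne_bot`), and then every element is `h(z)` with ONE `z`.

## References

* [Moonen2004MT] B. Moonen, *An introduction to Mumford–Tate groups* (2004), §4 Lemma 4.6, §5 (5.2). [cite: Moonen2004MT, §4 Lemma 4.6 and §5 (5.2)]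
* [CarlsonMullerStachPeters2017] J. Carlson, S. Müller-Stach, C. Peters (2017), §15.2 Problem 15.2.3 (a), Examples 15.2.4 (ii).
  [cite: CarlsonMullerStachPeters2017, §15.2 Problem 15.2.3 (a) and Examples 15.2.4 (ii)]
* [Deligne1982HodgeCycles] P. Deligne, *Hodge cycles on abelian varieties*, LNM 900 (1982), I §5 (p. 63). [cite: Deligne1982HodgeCycles, I §5 (p. 63)]
* [Imai1976HodgeGroups] H. Imai (1976), §3 Remarks (p. 370). [cite: Imai1976HodgeGroups, §3 Remarks (p. 370 L22–L25, L31–L38)]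
* [MoonenZarhin1999LowDim] B. Moonen, Yu. Zarhin (1999), (0.2)(4), §1, §3 Corollary. [cite: MoonenZarhin1999LowDim, (0.2)(4), §1 and §3 Corollary]
* [Gordon1997] B. B. Gordon (1997), §2.3 Lemma (iii), §3 Theorem. [cite: Gordon1997, §2.3 Lemma (iii) and §3 Theorem]
* [Lombardo2019] D. Lombardo (2019), §2.2 cases 5, 6. [cite: Lombardo2019, §2.2 cases 5 and 6]
* [Lange2023AbelianVarietiesComplex] H. Lange (2023), §7.2.1 Remark 7.2.2 (2), §7.2.3 Prop. 7.2.6. [cite: Lange2023AbelianVarietiesComplex, §7.2.1 Remark 7.2.2 (2) and §7.2.3 Prop. 7.2.6]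
* [Beauville2014MaximalPicard] A. Beauville (2014), §3 Prop. 3. [cite: Beauville2014MaximalPicard, §3 Prop. 3]
-/

noncomputable section

open scoped Matrix Real

open Function Module Matrix

namespace Literature.Geometry.Kaehler

namespace ComplexTorus

/-! ## §1 The multiplier relation on `MT(∏ₖ X_k)(ℝ)` for any finite family of complex tori -/

section Multiplier

variable {κ : Type*} [Fintype κ] [DecidableEq κ] {σ : κ → Type*} [∀ k, Fintype (σ k)] [∀ k, DecidableEq (σ k)]
  {F : κ → Type*} [∀ k, NormedAddCommGroup (F k)] [∀ k, NormedSpace ℂ (F k)]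
  (Ψ : ∀ k, (σ k → ℝ) ≃L[ℝ] F k)

/-- **THE COMMON MULTIPLIER: every `M ∈ MT(∏ₖ X_k)(ℝ)` has ONE `α ∈ ℂ^×` with `det(M_kk) = α^{#σ_k}` for every `k`** —
`M_ℂ = α · N` with `N ∈ Hg(∏ₖ X_k)(ℂ) ⊆ ∏ₖ Hg(X_k)(ℂ) ⊆ ∏ₖ SL(V_k)` (p40's `mem_mumfordTateGroup_iff_exists_smul`, p36's
`det_blockDiag'_of_mem_hodgeGroupC_sigmaPi`), so `det(M_kk) = α^{#σ_k} det(N_kk) = α^{#σ_k}` («`MT ⊂ 𝔾_m · (Hg(V₁) × Hg(V₂))`»,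
the scalar `α` being the common central factor). [cite: Moonen2004MT, §5 (5.2)] [cite: CarlsonMullerStachPeters2017, §15.2 Problem 15.2.3 (a)]
[cite: Lange2023AbelianVarietiesComplex, §7.2.1 Remark 7.2.2 (2)] -/
theorem exists_forall_det_blockDiag'_eq_pow_of_mem_mumfordTateGroup_sigmaPi {M : GL (Σ k, σ k) ℝ}
    (hM : M ∈ mumfordTateGroup (sigmaPiPeriod Ψ)) :
    ∃ α : ℂ, α ≠ 0 ∧ ∀ k, ((Matrix.blockDiag' (M : Matrix (Σ k, σ k) (Σ k, σ k) ℝ) k).det : ℂ) = α ^ Fintype.card (σ k) := by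
  obtain ⟨α, hα, N, hN, hMN⟩ := (mem_mumfordTateGroup_iff_exists_smul (sigmaPiPeriod Ψ)).1 hM
  refine ⟨α, hα, fun k ↦ ?_⟩
  have hk := congrArg (fun A : Matrix (Σ k, σ k) (Σ k, σ k) ℂ ↦ (Matrix.blockDiag' A k).det) hMN
  simp only [Matrix.blockDiag'_map, Matrix.blockDiag'_smul, Pi.smul_apply, Matrix.det_smul,
    det_blockDiag'_of_mem_hodgeGroupC_sigmaPi Ψ hN k, mul_one] at hk
  rw [← hk, ← Complex.ofRealHom_eq_coe, RingHom.map_det, RingHom.mapMatrix_apply]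

/-- **THE MULTIPLIER RELATION `det(M_kk)^{#σ_l} = det(M_ll)^{#σ_k}` FOR EVERY `M ∈ MT(∏ₖ X_k)(ℝ)` AND ALL `k, l`** (any finite
family of complex tori of any dimensions): `MT(∏ₖ X_k)` lies in the fibre product of the `MT(X_k)` over `𝔾_m` — Moonen's
(5.2) / CMSP's Problem 15.2.3 (a) for `r` summands (the tree's `det_pow_eq_of_blockDiagGL_mem_mumfordTateGroup_prod` is the case
of two). [cite: Moonen2004MT, §4 Lemma 4.6 and §5 (5.2)] [cite: CarlsonMullerStachPeters2017, §15.2 Problem 15.2.3 (a)]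
[cite: Deligne1982HodgeCycles, I §5 (p. 63)] -/
theorem det_blockDiag'_pow_eq_of_mem_mumfordTateGroup_sigmaPi {M : GL (Σ k, σ k) ℝ}
    (hM : M ∈ mumfordTateGroup (sigmaPiPeriod Ψ)) (k l : κ) :
    (Matrix.blockDiag' (M : Matrix (Σ k, σ k) (Σ k, σ k) ℝ) k).det ^ Fintype.card (σ l) =
      (Matrix.blockDiag' (M : Matrix (Σ k, σ k) (Σ k, σ k) ℝ) l).det ^ Fintype.card (σ k) := by
  obtain ⟨α, -, hα⟩ := exists_forall_det_blockDiag'_eq_pow_of_mem_mumfordTateGroup_sigmaPi Ψ hM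
  apply Complex.ofReal_injective
  rw [Complex.ofReal_pow, Complex.ofReal_pow, hα k, hα l, ← pow_mul, ← pow_mul, mul_comm]

/-- The multiplier relation for a block-diagonal element `diag(A_k) ∈ MT(∏ₖ X_k)(ℝ)`: **`det(A_k)^{#σ_l} = det(A_l)^{#σ_k}`**.
[cite: Moonen2004MT, §5 (5.2)] [cite: CarlsonMullerStachPeters2017, §15.2 Problem 15.2.3 (a)] -/
theorem det_pow_eq_of_sigmaBlockDiagGL_mem_mumfordTateGroup_sigmaPi {A : ∀ k, GL (σ k) ℝ}
    (h : sigmaBlockDiagGL σ ℝ A ∈ mumfordTateGroup (sigmaPiPeriod Ψ)) (k l : κ) :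
    (A k : Matrix (σ k) (σ k) ℝ).det ^ Fintype.card (σ l) = (A l : Matrix (σ l) (σ l) ℝ).det ^ Fintype.card (σ k) := by
  have h' := det_blockDiag'_pow_eq_of_mem_mumfordTateGroup_sigmaPi Ψ h k l
  rwa [blockDiag'_coe_sigmaBlockDiagGL, blockDiag'_coe_sigmaBlockDiagGL] at h'

/-- **`MT(∏ₖ X_k)(ℝ) < ∏ₖ MT(X_k)(ℝ)` AS SOON AS TWO FACTORS ARE NON-ZERO** (`k₁ ≠ k₂` with `σ k₁, σ k₂ ≠ ∅`): the element
`diag(2·1_{k₁}, 1, …, 1)` of `∏ₖ MT(X_k)(ℝ)` (scalars lie in every `MT(X_k)`) violates the multiplier relation — «the central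
factor `𝔾_m` is counted twice», «`MT(A₁ × A₂)` is almost never equal to `MT(A₁) × MT(A₂)`»; the tree's `mumfordTateGroup_prod_lt`
is the case of two factors. [cite: Moonen2004MT, §5 (5.2)] [cite: Lombardo2019, §2.2 cases 5 and 6] [cite: Deligne1982HodgeCycles, I §5 (p. 63)] -/
theorem mumfordTateGroup_sigmaPi_lt_of_ne {k₁ k₂ : κ} (hk : k₁ ≠ k₂) [Nonempty (σ k₁)] [Nonempty (σ k₂)] :
    mumfordTateGroup (sigmaPiPeriod Ψ) <
      (Subgroup.pi Set.univ fun k ↦ mumfordTateGroup (Ψ k)).map (sigmaBlockDiagGL σ ℝ) := by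
  refine lt_of_le_of_ne (mumfordTateGroup_sigmaPi_le Ψ) fun heq ↦ ?_
  -- the offending element: the scalar `2` in the block `k₁`, `1` elsewhere
  set two : ℝˣ := Units.mk0 2 two_ne_zero with htwo
  set A : ∀ k, GL (σ k) ℝ := Function.update 1 k₁ (Matrix.GeneralLinearGroup.scalar (σ k₁) two) with hA
  have hmem : sigmaBlockDiagGL σ ℝ A ∈ (Subgroup.pi Set.univ fun k ↦ mumfordTateGroup (Ψ k)).map (sigmaBlockDiagGL σ ℝ) := by
    refine Subgroup.mem_map.2 ⟨A, (Subgroup.mem_pi _).2 fun k _ ↦ ?_, rfl⟩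
    by_cases hkk : k = k₁
    · subst hkk
      rw [hA, Function.update_self]
      exact scalar_mem_mumfordTateGroup (Ψ k) two
    · rw [hA, Function.update_of_ne hkk, Pi.one_apply]
      exact one_mem _
  rw [← heq] at hmem
  have hdet := det_pow_eq_of_sigmaBlockDiagGL_mem_mumfordTateGroup_sigmaPi Ψ hmem k₁ k₂
  rw [hA, Function.update_self, Function.update_of_ne hk.symm, Pi.one_apply, Units.val_one, Matrix.det_one, one_pow,
    Matrix.GeneralLinearGroup.coe_scalar, Matrix.scalar_apply, Matrix.det_diagonal, Finset.prod_const, Finset.card_univ,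
    htwo, Units.val_mk0, ← pow_mul] at hdet
  have h1 : (2 : ℝ) ^ (Fintype.card (σ k₁) * Fintype.card (σ k₂)) = 1 := hdet
  have hlt : (1 : ℝ) < 2 ^ (Fintype.card (σ k₁) * Fintype.card (σ k₂)) :=
    one_lt_pow₀ one_lt_two (mul_ne_zero Fintype.card_ne_zero Fintype.card_ne_zero)
  exact hlt.ne' h1

end Multiplier

/-! ## §2 All factors on the Hodge-circle locus: `M = diag(h_k(z_k))`, `|z_k| = |z_l|` -/

section Locus

variable {κ : Type*} [Fintype κ] [DecidableEq κ] {σ : κ → Type*} [∀ k, Fintype (σ k)] [∀ k, DecidableEq (σ k)]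
  {F : κ → Type*} [∀ k, NormedAddCommGroup (F k)] [∀ k, NormedSpace ℂ (F k)] [∀ k, FiniteDimensional ℂ (F k)]
  (Ψ : ∀ k, (σ k → ℝ) ≃L[ℝ] F k)

omit [Fintype κ] [DecidableEq κ] [∀ k, DecidableEq (σ k)] in
/-- `g_k ≥ 1` ⟹ the lattice index `σ_k` is non-empty (`#σ_k = 2g_k`). [folklore] -/
private theorem nonempty_index_of_finrank_pos' (Ψ : ∀ k, (σ k → ℝ) ≃L[ℝ] F k) (hg : ∀ k, 0 < finrank ℂ (F k))
    (k : κ) : Nonempty (σ k) := by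
  rw [← Fintype.card_pos_iff, card_eq_two_mul_finrank (Ψ k)]
  exact Nat.mul_pos two_pos (hg k)

/-- **LEMMA 4.6 + THE MULTIPLIER ON THE HODGE-CIRCLE LOCUS, ANY FINITE NUMBER OF FACTORS: every `M ∈ MT(∏ₖ X_k)(ℝ)` is
`diag(h_k(z_k))` with `z_k ≠ 0` AND `|z_k| = |z_l|` for all `k, l`** (`M = diag(A_k)`, `A_k ∈ MT(X_k)(ℝ) = h_k(ℂ^×)` for tori on the
locus, `det h_k(z_k) = |z_k|^{#σ_k}`, and §1). The `r`-factor form of g33-#3's `exists_eq_fromBlocks_hodgeS_of_mem_mumfordTateGroup_prodPeriod`.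
[cite: Moonen2004MT, §4 Lemma 4.6 and §5 (5.2)] [cite: CarlsonMullerStachPeters2017, §15.2 Problem 15.2.3 (a) and Examples 15.2.4 (ii)]
[cite: Imai1976HodgeGroups, §3 Remarks (p. 370 L31–L38)] -/
theorem exists_eq_blockDiagonal'_hodgeS_of_mem_mumfordTateGroup_sigmaPiPeriod (hg : ∀ k, 0 < finrank ℂ (F k))
    (h : ∀ k, (hodgeGroup (Ψ k) : Set (SpecialLinearGroup (σ k) ℝ)) = Set.range (hodgeCircleSL (Ψ k)))
    {M : GL (Σ k, σ k) ℝ} (hM : M ∈ mumfordTateGroup (sigmaPiPeriod Ψ)) :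
    ∃ z : κ → ℂ, (∀ k, z k ≠ 0) ∧ (∀ k l, ‖z k‖ = ‖z l‖) ∧
      (M : Matrix (Σ k, σ k) (Σ k, σ k) ℝ) = Matrix.blockDiagonal' fun k ↦ hodgeS (Ψ k) (z k) := by
  haveI : ∀ k, Nonempty (σ k) := nonempty_index_of_finrank_pos' Ψ hg
  obtain ⟨A, hA, rfl⟩ := exists_eq_sigmaBlockDiagGL_of_mem_mumfordTateGroup_sigmaPi Ψ hM
  have hA' : ∀ k, ∃ z : ℂ, z ≠ 0 ∧ ((A k : GL (σ k) ℝ) : Matrix (σ k) (σ k) ℝ) = hodgeS (Ψ k) z := fun k ↦ by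
    have hk : A k ∈ (mumfordTateGroup (Ψ k) : Set (GL (σ k) ℝ)) := hA k
    rw [coe_mumfordTateGroup_eq_range_hodgeSGL_of_coe_hodgeGroup_eq_range (Ψ k) (h k), mem_range_hodgeSGL_iff] at hk
    exact hk
  choose z hz hAz using hA'
  have hdet := det_pow_eq_of_sigmaBlockDiagGL_mem_mumfordTateGroup_sigmaPi Ψ hM
  refine ⟨z, hz, fun k l ↦ ?_, ?_⟩
  · have hkl := hdet k l
    rw [hAz, hAz, det_hodgeS, det_hodgeS, ← pow_mul, ← pow_mul, mul_comm (Fintype.card (σ l))] at hkl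
    exact (pow_left_inj₀ (norm_nonneg _) (norm_nonneg _)
      (mul_ne_zero Fintype.card_ne_zero Fintype.card_ne_zero)).1 hkl
  · rw [coe_sigmaBlockDiagGL]
    exact congrArg Matrix.blockDiagonal' (funext hAz)

/-- … **in polar form: `M = ρ · diag(h_k(e^{iθ_k}))` with ONE `ρ > 0`** — «`MT ⊂ 𝔾_m · ∏ₖ Hg(X_k)`» holds on REAL points for
tori on the locus. [cite: CarlsonMullerStachPeters2017, §15.2 Problem 15.2.3 (a)] [cite: Gordon1997, §2.3 Lemma (iii)] -/
theorem exists_eq_smul_blockDiagonal'_hodgeCircle_of_mem_mumfordTateGroup_sigmaPiPeriod (hg : ∀ k, 0 < finrank ℂ (F k))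
    (h : ∀ k, (hodgeGroup (Ψ k) : Set (SpecialLinearGroup (σ k) ℝ)) = Set.range (hodgeCircleSL (Ψ k)))
    {M : GL (Σ k, σ k) ℝ} (hM : M ∈ mumfordTateGroup (sigmaPiPeriod Ψ)) :
    ∃ (ρ : ℝ) (θ : κ → ℝ), 0 < ρ ∧
      (M : Matrix (Σ k, σ k) (Σ k, σ k) ℝ) = ρ • Matrix.blockDiagonal' fun k ↦ hodgeCircle (Ψ k) (θ k) := by
  obtain ⟨z, hz, hnorm, hM'⟩ := exists_eq_blockDiagonal'_hodgeS_of_mem_mumfordTateGroup_sigmaPiPeriod Ψ hg h hM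
  rcases isEmpty_or_nonempty κ with hκ | ⟨⟨k₀⟩⟩
  · refine ⟨1, fun _ ↦ 0, one_pos, ?_⟩
    rw [hM', one_smul]
    exact congrArg Matrix.blockDiagonal' (funext fun k ↦ (IsEmpty.false k).elim)
  · refine ⟨‖z k₀‖, fun k ↦ Complex.arg (z k), norm_pos_iff.2 (hz k₀), ?_⟩
    rw [hM', ← Matrix.blockDiagonal'_smul]
    refine congrArg Matrix.blockDiagonal' (funext fun k ↦ ?_)
    rw [Pi.smul_apply, hodgeS_eq_norm_smul_hodgeCircle, hnorm k k₀]

/-- **`MT(∏ₖ X_k)(ℝ)` IS COMMUTATIVE FOR EVERY FINITE FAMILY OF TORI ON THE HODGE-CIRCLE LOCUS** (each `MT(X_k)(ℝ) = h_k(ℂ^×)`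
is commutative and `MT(∏) ⊆ ∏ MT(X_k)`): the product is of CM type in the Mumford–Tate sense («`MT(H¹(C)) = U(1) · 𝔾_m` … is also
abelian» factorwise). [cite: CarlsonMullerStachPeters2017, §15.2 Examples 15.2.4 (ii)] [cite: Lange2023AbelianVarietiesComplex, §7.2.3 Prop. 7.2.6]
[cite: Deligne1982HodgeCycles, I §5 (p. 63)] -/
theorem mumfordTateGroup_sigmaPiPeriod_comm_of_coe_eq_range (hg : ∀ k, 0 < finrank ℂ (F k))
    (h : ∀ k, (hodgeGroup (Ψ k) : Set (SpecialLinearGroup (σ k) ℝ)) = Set.range (hodgeCircleSL (Ψ k)))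
    {M N : GL (Σ k, σ k) ℝ} (hM : M ∈ mumfordTateGroup (sigmaPiPeriod Ψ)) (hN : N ∈ mumfordTateGroup (sigmaPiPeriod Ψ)) :
    M * N = N * M := by
  haveI : ∀ k, Nonempty (σ k) := nonempty_index_of_finrank_pos' Ψ hg
  exact mumfordTateGroup_sigmaPi_comm_of_forall Ψ
    (fun k _ hA _ hA' ↦ mumfordTateGroup_comm_of_coe_hodgeGroup_eq_range (Ψ k) (h k) hA hA') hM hN

/-! ## §3 The split branch: `MT(∏ₖ X_k)(ℝ) = {diag(h_k(z_k)) : |z_k| = |z_l| ≠ 0}`, `MT ∩ SL = Hg` -/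

omit [∀ k, FiniteDimensional ℂ (F k)] in
/-- A block-diagonal matrix of circle elements is the `SL`-element `diag(h_k(e^{iθ_k}))` viewed in `GL`. [folklore] -/
private theorem coe_toGL_sigmaBlockDiagSL_hodgeCircleSL (θ : κ → ℝ) :
    ((Matrix.SpecialLinearGroup.toGL (sigmaBlockDiagSL σ ℝ fun k ↦ hodgeCircleSL (Ψ k) (θ k)) : GL (Σ k, σ k) ℝ) :
        Matrix (Σ k, σ k) (Σ k, σ k) ℝ) = Matrix.blockDiagonal' fun k ↦ hodgeCircle (Ψ k) (θ k) := by
  rw [toGL_sigmaBlockDiagSL, coe_sigmaBlockDiagGL]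
  exact congrArg Matrix.blockDiagonal' (funext fun k ↦ by
    rw [Matrix.SpecialLinearGroup.coe_GL_coe_matrix, coe_hodgeCircleSL])

/-- **ON THE SPLIT BRANCH (pairwise `Hom = 0`) EVERY `diag(h_k(z_k))` WITH `|z_k| = |z_l| ≠ 0` LIES IN `MT(∏ₖ X_k)(ℝ)`**: it is
`ρ · diag(h_k(e^{iθ_k}))` with `diag(h_k(e^{iθ_k})) ∈ ∏ₖ Hg(X_k)(ℝ) = Hg(∏ₖ X_k)(ℝ)` (g33-#5) and `ℝ^× · Hg ⊆ MT`.
[cite: CarlsonMullerStachPeters2017, §15.2 Problem 15.2.3 (a)] [cite: Gordon1997, §2.3 Lemma (iii)] [cite: Imai1976HodgeGroups, §2 Proposition (p. 368)] -/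
theorem mem_mumfordTateGroup_sigmaPiPeriod_of_coe_eq_blockDiagonal'_hodgeS (hg : ∀ k, 0 < finrank ℂ (F k))
    (h : ∀ k, (hodgeGroup (Ψ k) : Set (SpecialLinearGroup (σ k) ℝ)) = Set.range (hodgeCircleSL (Ψ k)))
    (hhom : ∀ k l, k ≠ l → homRat (Ψ k) (Ψ l) = ⊥) {M : GL (Σ k, σ k) ℝ} {z : κ → ℂ} (hz : ∀ k, z k ≠ 0)
    (hnorm : ∀ k l, ‖z k‖ = ‖z l‖)
    (hM : (M : Matrix (Σ k, σ k) (Σ k, σ k) ℝ) = Matrix.blockDiagonal' fun k ↦ hodgeS (Ψ k) (z k)) :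
    M ∈ mumfordTateGroup (sigmaPiPeriod Ψ) := by
  rcases isEmpty_or_nonempty κ with hκ | ⟨⟨k₀⟩⟩
  · have hM1 : M = 1 := Units.ext (Subsingleton.elim _ _)
    rw [hM1]
    exact one_mem _
  -- `M = ρ · diag(h_k(e^{iθ_k}))`, `ρ = |z_{k₀}| > 0`
  set ρ : ℝˣ := Units.mk0 ‖z k₀‖ (norm_ne_zero_iff.2 (hz k₀)) with hρ
  have hP : sigmaBlockDiagSL σ ℝ (fun k ↦ hodgeCircleSL (Ψ k) (Complex.arg (z k))) ∈ hodgeGroup (sigmaPiPeriod Ψ) := by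
    rw [hodgeGroup_sigmaPiPeriod_eq_map_of_coe_eq_range_of_pairwise_homRat_eq_bot Ψ hg h hhom]
    exact Subgroup.mem_map.2 ⟨fun k ↦ hodgeCircleSL (Ψ k) (Complex.arg (z k)),
      (Subgroup.mem_pi _).2 fun k _ ↦ hodgeCircleSL_mem_hodgeGroup (Ψ k) _, rfl⟩
  have hMeq : M = Matrix.GeneralLinearGroup.scalar (Σ k, σ k) ρ *
      Matrix.SpecialLinearGroup.toGL (sigmaBlockDiagSL σ ℝ fun k ↦ hodgeCircleSL (Ψ k) (Complex.arg (z k))) := by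
    refine Units.ext ?_
    rw [Units.val_mul, Matrix.GeneralLinearGroup.coe_scalar, Matrix.scalar_apply, ← Matrix.smul_one_eq_diagonal,
      Matrix.smul_mul, Matrix.one_mul, coe_toGL_sigmaBlockDiagSL_hodgeCircleSL, hM, ← Matrix.blockDiagonal'_smul]
    refine congrArg Matrix.blockDiagonal' (funext fun k ↦ ?_)
    rw [Pi.smul_apply, hodgeS_eq_norm_smul_hodgeCircle, hnorm k k₀, hρ, Units.val_mk0]
  rw [hMeq]
  exact scalar_mul_toGL_mem_mumfordTateGroup (sigmaPiPeriod Ψ) ρ hP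

/-- **THE MUMFORD–TATE GROUP ON THE SPLIT BRANCH, REAL POINTS: `M ∈ MT(∏ₖ X_k)(ℝ) ⟺ M = diag(h_k(z_k))` with `z_k ≠ 0`,
`|z_k| = |z_l|`** — for tori on the locus with pairwise `Hom = 0` the Mumford–Tate group is exactly the fibre product of the
`h_k(ℂ^×)` over `𝔾_m`, the torus `𝔾_m · ∏ₖ U(1)` of rank `#κ + 1` (the `r`-factor form of g33-#3 §2, Lombardo's case 5).
[cite: CarlsonMullerStachPeters2017, §15.2 Problem 15.2.3 (a)] [cite: Moonen2004MT, §4 Lemma 4.6 and §5 (5.2)]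
[cite: Lombardo2019, §2.2 case 5] [cite: Imai1976HodgeGroups, §2 Proposition (p. 368) and §3 Remarks (p. 370)] -/
theorem mem_mumfordTateGroup_sigmaPiPeriod_iff_of_pairwise_homRat_eq_bot (hg : ∀ k, 0 < finrank ℂ (F k))
    (h : ∀ k, (hodgeGroup (Ψ k) : Set (SpecialLinearGroup (σ k) ℝ)) = Set.range (hodgeCircleSL (Ψ k)))
    (hhom : ∀ k l, k ≠ l → homRat (Ψ k) (Ψ l) = ⊥) {M : GL (Σ k, σ k) ℝ} :
    M ∈ mumfordTateGroup (sigmaPiPeriod Ψ) ↔ ∃ z : κ → ℂ, (∀ k, z k ≠ 0) ∧ (∀ k l, ‖z k‖ = ‖z l‖) ∧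
      (M : Matrix (Σ k, σ k) (Σ k, σ k) ℝ) = Matrix.blockDiagonal' fun k ↦ hodgeS (Ψ k) (z k) :=
  ⟨exists_eq_blockDiagonal'_hodgeS_of_mem_mumfordTateGroup_sigmaPiPeriod Ψ hg h, fun ⟨_, hz, hnorm, hM⟩ ↦
    mem_mumfordTateGroup_sigmaPiPeriod_of_coe_eq_blockDiagonal'_hodgeS Ψ hg h hhom hz hnorm hM⟩

/-- **Every sign vector `diag(ε_k · 1)`, `ε_k = ±1`, lies in `MT(∏ₖ X_k)(ℝ)` on the split branch** (`= diag(h_k(ε_k))`, all of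
norm `1`) — e.g. `diag(1, …, 1, −1)`: the split Mumford–Tate group is NOT `h(ℂ^×)` (the `r`-factor form of g33-#3's `(1, −1) ∈ MT`).
[cite: Lombardo2019, §2.2 case 5] [cite: CarlsonMullerStachPeters2017, §15.2 Problem 15.2.3 (a)] -/
theorem sigmaBlockDiagGL_sign_mem_mumfordTateGroup_sigmaPiPeriod_of_pairwise_homRat_eq_bot
    (hg : ∀ k, 0 < finrank ℂ (F k))
    (h : ∀ k, (hodgeGroup (Ψ k) : Set (SpecialLinearGroup (σ k) ℝ)) = Set.range (hodgeCircleSL (Ψ k)))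
    (hhom : ∀ k l, k ≠ l → homRat (Ψ k) (Ψ l) = ⊥) (S : Finset κ) :
    sigmaBlockDiagGL σ ℝ (fun k ↦ if k ∈ S then -1 else 1) ∈ mumfordTateGroup (sigmaPiPeriod Ψ) := by
  refine mem_mumfordTateGroup_sigmaPiPeriod_of_coe_eq_blockDiagonal'_hodgeS Ψ hg h hhom
    (z := fun k ↦ if k ∈ S then -1 else 1) (fun k ↦ by split_ifs <;> norm_num) (fun k l ↦ by
      split_ifs <;> simp) ?_
  rw [coe_sigmaBlockDiagGL]
  refine congrArg Matrix.blockDiagonal' (funext fun k ↦ ?_)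
  split_ifs
  · rw [Units.val_neg, Units.val_one, show (-1 : ℂ) = ((-1 : ℝ) : ℂ) by push_cast; ring, hodgeS_ofReal, neg_smul,
      one_smul]
  · rw [Units.val_one, show (1 : ℂ) = ((1 : ℝ) : ℂ) by push_cast; ring, hodgeS_ofReal, one_smul]

/-- **`MT(∏ₖ X_k)(ℝ) ∩ SL = Hg(∏ₖ X_k)(ℝ)` ON THE SPLIT BRANCH**: `P ∈ Hg(∏ₖ X_k)(ℝ) ⟺ P ∈ MT(∏ₖ X_k)(ℝ)` for `P ∈ SL` (an
element `ρ · diag(h_k(e^{iθ_k}))` of determinant `1` has `ρ = 1`). The `r`-factor form of g33-#3's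
`mem_hodgeGroup_prodPeriod_iff_toGL_mem_mumfordTateGroup_of_homRat_eq_bot`. [cite: Gordon1997, §2.3 Lemma (iii)]
[cite: CarlsonMullerStachPeters2017, §15.2 Problem 15.2.3 (a)] -/
theorem mem_hodgeGroup_sigmaPiPeriod_iff_toGL_mem_mumfordTateGroup_of_pairwise_homRat_eq_bot
    (hg : ∀ k, 0 < finrank ℂ (F k))
    (h : ∀ k, (hodgeGroup (Ψ k) : Set (SpecialLinearGroup (σ k) ℝ)) = Set.range (hodgeCircleSL (Ψ k)))
    (hhom : ∀ k l, k ≠ l → homRat (Ψ k) (Ψ l) = ⊥) {P : SpecialLinearGroup (Σ k, σ k) ℝ} :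
    P ∈ hodgeGroup (sigmaPiPeriod Ψ) ↔ (Matrix.SpecialLinearGroup.toGL P : GL (Σ k, σ k) ℝ) ∈ mumfordTateGroup (sigmaPiPeriod Ψ) := by
  refine ⟨toGL_mem_mumfordTateGroup (sigmaPiPeriod Ψ), fun hP ↦ ?_⟩
  rcases isEmpty_or_nonempty κ with hκ | ⟨⟨k₀⟩⟩
  · have hP1 : P = 1 := Subtype.ext (Subsingleton.elim _ _)
    rw [hP1]
    exact one_mem _
  haveI : ∀ k, Nonempty (σ k) := nonempty_index_of_finrank_pos' Ψ hg
  haveI : Nonempty (Σ k, σ k) := ⟨⟨k₀, Classical.arbitrary _⟩⟩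
  obtain ⟨ρ, θ, hρ, hPρ⟩ := exists_eq_smul_blockDiagonal'_hodgeCircle_of_mem_mumfordTateGroup_sigmaPiPeriod Ψ hg h hP
  -- `det P = 1` forces `ρ = 1`
  have hdet := congrArg Matrix.det hPρ
  rw [Matrix.SpecialLinearGroup.coe_GL_coe_matrix, P.2, Matrix.det_smul, ← coe_toGL_sigmaBlockDiagSL_hodgeCircleSL,
    Matrix.SpecialLinearGroup.coe_GL_coe_matrix, Matrix.SpecialLinearGroup.det_coe, mul_one] at hdet
  have hρ1 : ρ = 1 := by
    have hcard : Fintype.card (Σ k, σ k) ≠ 0 := Fintype.card_ne_zero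
    exact (pow_eq_one_iff_of_ne_zero hcard |>.1 hdet.symm).resolve_right (by
      rintro ⟨hneg, -⟩
      linarith)
  rw [hρ1, one_smul, ← coe_toGL_sigmaBlockDiagSL_hodgeCircleSL, Matrix.SpecialLinearGroup.coe_GL_coe_matrix,
    Matrix.SpecialLinearGroup.coe_GL_coe_matrix] at hPρ
  have hPeq : P = sigmaBlockDiagSL σ ℝ fun k ↦ hodgeCircleSL (Ψ k) (θ k) := Subtype.ext hPρ
  rw [hPeq, hodgeGroup_sigmaPiPeriod_eq_map_of_coe_eq_range_of_pairwise_homRat_eq_bot Ψ hg h hhom]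
  exact Subgroup.mem_map.2 ⟨fun k ↦ hodgeCircleSL (Ψ k) (θ k),
    (Subgroup.mem_pi _).2 fun k _ ↦ hodgeCircleSL_mem_hodgeGroup (Ψ k) _, rfl⟩

/-! ## §4 The one-class branch: `MT(∏ₖ X_k)(ℝ) = h(ℂ^×)` ⟺ all pairwise `Hom ≠ 0` -/

/-- **`MT(∏ₖ X_k)(ℝ) = h(ℂ^×)` ⟺ `Hom_ℚ(X_k, X_l) ≠ 0` FOR ALL `k ≠ l`** (⟺ the product is itself on the locus, g33-#8 §4; the
Deligne torus of a power of one CM curve up to isogeny) — Lombardo's case 6 for `r` factors; non-empty family.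
[cite: Lombardo2019, §2.2 case 6] [cite: Imai1976HodgeGroups, §3 Remarks (p. 370 L22–L25)] [cite: Beauville2014MaximalPicard, §3 Prop. 3]
[cite: Lange2023AbelianVarietiesComplex, §7.2.1 Remark 7.2.2 (2)] -/
theorem coe_mumfordTateGroup_sigmaPiPeriod_eq_range_hodgeSGL_iff_forall_homRat_ne_bot [Nonempty κ]
    (hg : ∀ k, 0 < finrank ℂ (F k))
    (h : ∀ k, (hodgeGroup (Ψ k) : Set (SpecialLinearGroup (σ k) ℝ)) = Set.range (hodgeCircleSL (Ψ k))) :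
    (mumfordTateGroup (sigmaPiPeriod Ψ) : Set (GL (Σ k, σ k) ℝ)) = Set.range (hodgeSGL (sigmaPiPeriod Ψ)) ↔
      ∀ k l, k ≠ l → homRat (Ψ k) (Ψ l) ≠ ⊥ := by
  haveI : ∀ k, Nonempty (σ k) := nonempty_index_of_finrank_pos' Ψ hg
  haveI : Nonempty (Σ k, σ k) := ⟨⟨Classical.arbitrary κ, Classical.arbitrary _⟩⟩
  rw [coe_mumfordTateGroup_eq_range_hodgeSGL_iff_coe_hodgeGroup_eq_range (sigmaPiPeriod Ψ),
    coe_hodgeGroup_sigmaPiPeriod_eq_range_iff_forall_homRat_ne_bot Ψ hg h]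

/-- **… and then every `M ∈ MT(∏ₖ X_k)(ℝ)` is `h(z) = diag(h_k(z))` with ONE `z ∈ ℂ^×`** (all angles equal, not only the norms).
[cite: Imai1976HodgeGroups, §3 Remarks (p. 370 L22–L25: "the diagonal")] [cite: Lombardo2019, §2.2 case 6] -/
theorem exists_eq_hodgeS_of_mem_mumfordTateGroup_sigmaPiPeriod_of_forall_homRat_ne_bot [Nonempty κ]
    (hg : ∀ k, 0 < finrank ℂ (F k))
    (h : ∀ k, (hodgeGroup (Ψ k) : Set (SpecialLinearGroup (σ k) ℝ)) = Set.range (hodgeCircleSL (Ψ k)))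
    (hall : ∀ k l, k ≠ l → homRat (Ψ k) (Ψ l) ≠ ⊥) {M : GL (Σ k, σ k) ℝ} (hM : M ∈ mumfordTateGroup (sigmaPiPeriod Ψ)) :
    ∃ z : ℂ, z ≠ 0 ∧ (M : Matrix (Σ k, σ k) (Σ k, σ k) ℝ) = Matrix.blockDiagonal' fun k ↦ hodgeS (Ψ k) z := by
  haveI : ∀ k, Nonempty (σ k) := nonempty_index_of_finrank_pos' Ψ hg
  haveI : Nonempty (Σ k, σ k) := ⟨⟨Classical.arbitrary κ, Classical.arbitrary _⟩⟩
  have hM' : M ∈ (mumfordTateGroup (sigmaPiPeriod Ψ) : Set (GL (Σ k, σ k) ℝ)) := hM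
  rw [(coe_mumfordTateGroup_sigmaPiPeriod_eq_range_hodgeSGL_iff_forall_homRat_ne_bot Ψ hg h).2 hall,
    mem_range_hodgeSGL_iff] at hM'
  obtain ⟨z, hz, hMz⟩ := hM'
  exact ⟨z, hz, hMz.trans (hodgeS_sigmaPiPeriod Ψ z)⟩

end Locus

end ComplexTorus

end Literature.Geometry.Kaehler
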